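import Mathlib
import HarnessLib
import Literature.Topology.FourManifolds.MorseExtrema
import Summits.NavierStokesRegularity.NavierStokesRegularity.Theorems.HalfSpaceWindowDoorCirculationCarryingRigidityGaussExtremalTilting

/-!
# Route `HalfSpaceWindowDoor`, crux `CirculationCarryingRigidity` (stmt-NavierStokesRegularity-25311) —
# the FULL HESSIAN condition at the Gaussian-extremal point: DIRECTIONAL second moments `⟨⟪y,e⟫²⟩_{G₁ω₃} ≤ 2‖e‖²`

LEAD ns-hsw-p1 g8 (cell pub-ns-dss), `--supports stmt-NavierStokesRegularity-25311 --as helper`; sequel of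
`…GaussExtremalConditions` / `…GaussExtremalMoments` / `…GaussExtremalTilting` (LEAD g7).  There the AXIS maximality (E1)
`Θ(1,y) ≤ Θ(1,0)` of `Θ = e^{tΔ}ω₃^W(−1)` at the Gaussian-extremal point was used only through its trace `ΔΘ(1,·)(0) ≤ 0`, i.e.
`∫‖y‖²G₁ω₃ ≤ 6∫G₁ω₃`.  Axis maximality says more: the whole Hessian of `Θ(1,·)` at `0` is negative semidefinite.  By Folland's
formula for pure second derivatives of the caloric extension (`fderiv_fderiv_heatExtension_apply_eq_integral`:
`∂ₑ∂ₑΘ(1,·)(0) = ∫ (⟪y,e⟫²/4 − ‖e‖²/2) G₁(y) ω₃(y) dy`) this is the family of DIRECTIONAL moment bounds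

* `gaussExtremal_hessian` — if W6 fails at constant `C`, there is a closed-hemisphere door-class `W` (constant `C`),
  `ω := ⟪curl W(−1), e₃⟫ ≥ 0`, `M₀ := ∫G₁ω > 0`, with **`∫ ⟪y,e⟫² G₁(y) ω(y) dy ≤ 2‖e‖²·M₀` for EVERY `e`**, the lower trace bound
  `2M₀ ≤ ∫‖y‖²G₁ω` (scale maximality (E2)) and the maximal-inflow identity `ℐ(1;0)[W(−1)] = −2·(4π)^{3/2}·2·M₀` (E3).
  A straight vertical vortex column `ω = Φ₀δ(x_h)` has `⟨y₃²⟩ = 2`, `⟨y₀²⟩ = ⟨y₁²⟩ = 0`: the bound `2` is attained in the axial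
  direction by the column and the extremal slice is, direction by direction, no more spread than that.  In coordinates
  (`gaussExtremal_hessian_coord`): `∫yᵢ²G₁ω ≤ 2M₀` (`i = 0,1,2`), hence the HORIZONTAL moment `∫(y₀²+y₁²)G₁ω ≤ 4M₀` (the trace bound
  gave only `6M₀`) and the vertical moment `∫y₂²G₁ω ≤ 2M₀`, while `2M₀ ≤ ∫‖y‖²G₁ω`.
* `hemisphereLiouvilleE3_of_hessian`, `circulationCarryingRigidity_of_hessian` — the corresponding reductions of W6 and of the crux.
  (Sequel `…GaussExtremalTiltingSharp`: the horizontal bound sharpens the g7 tilting window to `(2 ± 2C)·M₀`.)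

WHAT THIS IS NOT: not a statement about Navier–Stokes regularity; door statements concern HYPOTHETICAL blow-up profiles (KNSS ancient
mild solutions).  No item is closed by this file.
-/

noncomputable section

-- the summit and its single sub-problem share the name (CONVENTIONS §1), as in every Theorems file
set_option linter.dupNamespace false

namespace Summit.NavierStokesRegularity.NavierStokesRegularity.Theorems.HalfSpaceWindowDoorCirculationCarryingRigidityGaussExtremalHessian

open MeasureTheory Set Function Filter Topology
open scoped RealInnerProductSpace InnerProductSpace Laplacian
open Literature.Analysis Literature.Analysis.FluidPDE Literature.Analysis.UnboundedOperators
open Summit.NavierStokesRegularity.NavierStokesRegularity.Theses.HalfSpaceWindowDoor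
open Summit.NavierStokesRegularity.NavierStokesRegularity.Theorems.HalfSpaceWindowDoorCirculationCarryingRigidityDefs
open Summit.NavierStokesRegularity.NavierStokesRegularity.Theorems.HalfSpaceWindowDoorCirculationCarryingRigidityReduction
  (circulationCarryingRigidity_of_hemisphereLiouvilleE3)
open Summit.NavierStokesRegularity.NavierStokesRegularity.Theorems.HalfSpaceWindowDoorCirculationCarryingRigidityGaussKernel
  (inner_e3_apply)
open Summit.NavierStokesRegularity.NavierStokesRegularity.Theorems.HalfSpaceWindowDoorCirculationCarryingRigidityGaussExtremalConditions
  (gaussExtremal_conditions omega3_continuous_bounded heatKernel_sub_comm)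
open Summit.NavierStokesRegularity.NavierStokesRegularity.Theorems.HalfSpaceWindowDoorCirculationCarryingRigidityGaussExtremalTilting
  (slice_components)

variable {C : ℝ}

/-! ### Folland's formula at the axis point and the Hessian sign -/

/-- **Pure second derivatives of `Θ(1,·) = e^{Δ}ω` at the origin as Gaussian moments**: for bounded continuous `ω`,
`D²Θ(1,·)(0)[e,e] = ∫ (⟪y,e⟫²/4 − ‖e‖²/2)·(G₁(y) ω(y)) dy`. -/
theorem hessian_heatExtension_one_zero {ω : EuclideanSpace ℝ (Fin 3) → ℝ} (hωc : Continuous ω) {B : ℝ} (hωB : ∀ x, ‖ω x‖ ≤ B)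
    (e : EuclideanSpace ℝ (Fin 3)) :
    fderiv ℝ (fderiv ℝ (heatExtension ω 1)) 0 e e = ∫ y, (⟪y, e⟫ ^ 2 / 4 - ‖e‖ ^ 2 / 2) * (heatKernel 1 y * ω y) := by
  have hC2 : ContDiff ℝ 2 (heatExtension ω 1) := contDiff_heatExtension_of_bound hωc hωB one_pos
  have hd : DifferentiableAt ℝ (fderiv ℝ (heatExtension ω 1)) 0 :=
    ((hC2.fderiv_right (m := 1) le_rfl).differentiable one_ne_zero) 0
  have hswap : fderiv ℝ (fderiv ℝ (heatExtension ω 1)) 0 e e = fderiv ℝ (fun y => fderiv ℝ (heatExtension ω 1) y e) 0 e := by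
    rw [fderiv_clm_apply hd (differentiableAt_const e)]
    simp
  rw [hswap, fderiv_fderiv_heatExtension_apply_eq_integral one_pos (memLp_top_of_continuous_of_bound hωc hωB) le_top 0 e]
  congr 1; funext y
  rw [heatKernel_sub_comm, sub_zero, zero_sub, inner_neg_left, smul_eq_mul]
  ring

/-- At a global maximum point `0` of `Θ(1,·)` the Gaussian directional second moment is at most `2‖e‖²` times the mass:
`∫⟪y,e⟫²G₁ω ≤ 2‖e‖²∫G₁ω`. -/
theorem directionalMoment_le_of_axisMax {ω : EuclideanSpace ℝ (Fin 3) → ℝ} (hωc : Continuous ω) {B : ℝ} (hωB : ∀ x, ‖ω x‖ ≤ B)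
    (hmax : ∀ y, heatExtension ω 1 y ≤ heatExtension ω 1 0) (e : EuclideanSpace ℝ (Fin 3)) :
    ∫ y, ⟪y, e⟫ ^ 2 * heatKernel 1 y * ω y ≤ 2 * ‖e‖ ^ 2 * ∫ y, heatKernel 1 y * ω y := by
  have hC2 : ContDiff ℝ 2 (heatExtension ω 1) := contDiff_heatExtension_of_bound hωc hωB one_pos
  have hloc : IsLocalMax (heatExtension ω 1) 0 := Eventually.of_forall fun y => hmax y
  have hneg := Literature.Topology.FourManifolds.IsLocalMax.fderiv_fderiv_apply_self_nonpos hC2.contDiffAt hloc e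
  rw [hessian_heatExtension_one_zero hωc hωB e] at hneg
  -- integrability of the two moments
  have hint0 : Integrable (fun y : EuclideanSpace ℝ (Fin 3) => heatKernel 1 y * ω y) :=
    ((integrable_heatKernel_holds (E := EuclideanSpace ℝ (Fin 3)) one_pos).bdd_mul hωc.aestronglyMeasurable
      (ae_of_all _ fun x => hωB x)).congr (ae_of_all _ fun x => by simp [mul_comm])
  have hint2 : Integrable (fun y : EuclideanSpace ℝ (Fin 3) => ⟪y, e⟫ ^ 2 * heatKernel 1 y * ω y) := by
    have h2 : Integrable (fun y : EuclideanSpace ℝ (Fin 3) => ‖y‖ ^ 2 * heatKernel 1 y * ω y) :=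
      ((integrable_norm_sq_mul_heatKernel (E := EuclideanSpace ℝ (Fin 3)) one_pos).bdd_mul hωc.aestronglyMeasurable
        (ae_of_all _ fun x => hωB x)).congr (ae_of_all _ fun x => by simp only; ring)
    refine (h2.const_mul (‖e‖ ^ 2)).mono ?_ (ae_of_all _ fun y => ?_)
    · have hc : Continuous fun y : EuclideanSpace ℝ (Fin 3) => ⟪y, e⟫ ^ 2 * heatKernel 1 y * ω y := by
        have : Continuous fun y : EuclideanSpace ℝ (Fin 3) => heatKernel 1 y := by unfold heatKernel; fun_prop
        fun_prop
      exact hc.aestronglyMeasurable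
    · have hG : 0 ≤ heatKernel 1 y := (heatKernel_pos one_pos _).le
      have hcs : ⟪y, e⟫ ^ 2 ≤ ‖y‖ ^ 2 * ‖e‖ ^ 2 := by
        have h := abs_real_inner_le_norm y e
        have h' : |⟪y, e⟫| ^ 2 ≤ (‖y‖ * ‖e‖) ^ 2 := pow_le_pow_left₀ (abs_nonneg _) h 2
        rw [sq_abs] at h'; nlinarith
      rw [Real.norm_eq_abs, abs_mul, abs_mul, abs_of_nonneg hG, abs_of_nonneg (sq_nonneg ⟪y, e⟫), Real.norm_eq_abs, abs_mul,
        abs_of_nonneg (sq_nonneg ‖e‖), abs_mul, abs_mul, abs_of_nonneg (sq_nonneg ‖y‖), abs_of_nonneg hG]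
      calc ⟪y, e⟫ ^ 2 * heatKernel 1 y * |ω y| ≤ ‖y‖ ^ 2 * ‖e‖ ^ 2 * heatKernel 1 y * |ω y| := by gcongr
        _ = ‖e‖ ^ 2 * (‖y‖ ^ 2 * heatKernel 1 y * |ω y|) := by ring
  have hsplit : ∫ y, (⟪y, e⟫ ^ 2 / 4 - ‖e‖ ^ 2 / 2) * (heatKernel 1 y * ω y) =
      (1 / 4) * (∫ y, ⟪y, e⟫ ^ 2 * heatKernel 1 y * ω y) - (‖e‖ ^ 2 / 2) * (∫ y, heatKernel 1 y * ω y) := by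
    have heq : (fun y : EuclideanSpace ℝ (Fin 3) => (⟪y, e⟫ ^ 2 / 4 - ‖e‖ ^ 2 / 2) * (heatKernel 1 y * ω y)) =
        fun y => (1 / 4) * (⟪y, e⟫ ^ 2 * heatKernel 1 y * ω y) - (‖e‖ ^ 2 / 2) * (heatKernel 1 y * ω y) := by
      funext y; ring
    rw [heq, integral_sub (hint2.const_mul _) (hint0.const_mul _), integral_const_mul, integral_const_mul]
  rw [hsplit] at hneg
  linarith

/-! ### The Hessian condition at the Gaussian-extremal point -/

/-- **THE FULL HESSIAN CONDITION at the Gaussian-extremal point.**  If some closed-hemisphere door-class profile (Type-I constant `C`)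
has `⟪curl v(s₁)(y₁), e₃⟫ > 0` somewhere, there is a closed-hemisphere door-class `W` (constant `C`) with `ω := ⟪curl W(−1), e₃⟫` such that
`M₀ := ∫G₁ω > 0`, `∫⟪y,e⟫²G₁(y)ω(y)dy ≤ 2‖e‖²M₀` for EVERY direction `e`, `2M₀ ≤ ∫‖y‖²G₁ω`, and
`ℐ(1;0)[W(−1)] = −2·(4π)^{3/2}·2·M₀`. -/
theorem gaussExtremal_hessian {v : ℝ → EuclideanSpace ℝ (Fin 3) → EuclideanSpace ℝ (Fin 3)} (hv : InDoorClass C v)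
    (hsign : SignE3 v) (hpos : ∃ s < 0, ∃ y, 0 < ⟪curl (v s) y, e3⟫) :
    ∃ W : ℝ → EuclideanSpace ℝ (Fin 3) → EuclideanSpace ℝ (Fin 3), InDoorClass C W ∧ SignE3 W ∧
      0 < ∫ y, heatKernel 1 y * ⟪curl (W (-1)) y, e3⟫ ∧
      (∀ e : EuclideanSpace ℝ (Fin 3),
        ∫ y, ⟪y, e⟫ ^ 2 * heatKernel 1 y * ⟪curl (W (-1)) y, e3⟫ ≤ 2 * ‖e‖ ^ 2 * ∫ y, heatKernel 1 y * ⟪curl (W (-1)) y, e3⟫) ∧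
      2 * ∫ y, heatKernel 1 y * ⟪curl (W (-1)) y, e3⟫ ≤ ∫ y, ‖y‖ ^ 2 * heatKernel 1 y * ⟪curl (W (-1)) y, e3⟫ ∧
      gaussInflow 1 0 (W (-1)) = -2 * ((4 * Real.pi) ^ ((3 : ℝ) / 2) * 2 * ∫ y, heatKernel 1 y * ⟪curl (W (-1)) y, e3⟫) := by
  obtain ⟨W, hW, hWs, h0, haxis, -, -, hsc, hI⟩ := gaussExtremal_conditions hv hsign hpos
  set ω : EuclideanSpace ℝ (Fin 3) → ℝ := fun x => ⟪curl (W (-1)) x, e3⟫ with hω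
  obtain ⟨hωc', B, hωB'⟩ := omega3_continuous_bounded hW (by norm_num : (-1 : ℝ) < 0)
  have hωc : Continuous ω := hωc'
  have hωB : ∀ x, ‖ω x‖ ≤ B := hωB'
  -- `Θ(1,0)` as a Gaussian integral
  have hΘ : heatExtension ω 1 0 = ∫ y, heatKernel 1 y * ω y := by
    rw [heatExtension_eq_integral_mul]
    congr 1; funext z; rw [heatKernel_sub_comm, sub_zero]
  -- `ΔΘ(1,·)(0)` by Folland's formula
  have hΔ : (Δ (heatExtension ω 1)) 0 = ∫ y, (‖y‖ ^ 2 / 4 - 3 / 2) * (heatKernel 1 y * ω y) := by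
    rw [laplacian_heatExtension_eq_integral one_pos (memLp_top_of_continuous_of_bound hωc hωB) le_top 0]
    congr 1; funext y
    rw [heatKernel_sub_comm, sub_zero, zero_sub, norm_neg, finrank_euclideanSpace_fin, smul_eq_mul]
    push_cast
    ring
  have hint0 : Integrable (fun y : EuclideanSpace ℝ (Fin 3) => heatKernel 1 y * ω y) :=
    ((integrable_heatKernel_holds (E := EuclideanSpace ℝ (Fin 3)) one_pos).bdd_mul hωc.aestronglyMeasurable
      (ae_of_all _ fun x => hωB x)).congr (ae_of_all _ fun x => by simp [mul_comm])
  have hint2 : Integrable (fun y : EuclideanSpace ℝ (Fin 3) => ‖y‖ ^ 2 * heatKernel 1 y * ω y) :=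
    ((integrable_norm_sq_mul_heatKernel (E := EuclideanSpace ℝ (Fin 3)) one_pos).bdd_mul hωc.aestronglyMeasurable
      (ae_of_all _ fun x => hωB x)).congr (ae_of_all _ fun x => by simp only; ring)
  have hsplit : ∫ y, (‖y‖ ^ 2 / 4 - 3 / 2) * (heatKernel 1 y * ω y) =
      (1 / 4) * (∫ y, ‖y‖ ^ 2 * heatKernel 1 y * ω y) - (3 / 2) * (∫ y, heatKernel 1 y * ω y) := by
    have heq : (fun y : EuclideanSpace ℝ (Fin 3) => (‖y‖ ^ 2 / 4 - 3 / 2) * (heatKernel 1 y * ω y)) =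
        fun y => (1 / 4) * (‖y‖ ^ 2 * heatKernel 1 y * ω y) - (3 / 2) * (heatKernel 1 y * ω y) := by
      funext y; ring
    rw [heq, integral_sub (hint2.const_mul _) (hint0.const_mul _), integral_const_mul, integral_const_mul]
  have hdir : ∀ e : EuclideanSpace ℝ (Fin 3), ∫ y, ⟪y, e⟫ ^ 2 * heatKernel 1 y * ω y ≤ 2 * ‖e‖ ^ 2 * ∫ y, heatKernel 1 y * ω y :=
    fun e => directionalMoment_le_of_axisMax hωc hωB haxis e
  rw [hΘ] at h0 hsc hI
  rw [hΔ, hsplit] at hsc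
  refine ⟨W, hW, hWs, h0, hdir, ?_, hI⟩
  linarith

/-- Coordinates as inner products with the standard basis: `⟪y, single i 1⟫ = y i`, and `‖single i 1‖ = 1`. -/
theorem inner_single_one_eq (y : EuclideanSpace ℝ (Fin 3)) (i : Fin 3) :
    ⟪y, EuclideanSpace.single i (1 : ℝ)⟫ = y i := by
  rw [EuclideanSpace.inner_single_right]; simp

/-- **THE HESSIAN CONDITION IN COORDINATES.**  At the Gaussian-extremal point (some extremal profile of every enemy of W6 with constant
`C`): `M₀ = ∫G₁ω₃ > 0`; `∫yᵢ²G₁ω₃ ≤ 2M₀` for `i = 0, 1, 2`; hence the horizontal moment `∫(y₀²+y₁²)G₁ω₃ ≤ 4M₀`; and `2M₀ ≤ ∫‖y‖²G₁ω₃`;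
with the maximal-inflow identity (E3).  (Component spelling `curl (W (-1)) y 2 = ⟪curl W(−1)(y), e₃⟫`.) -/
theorem gaussExtremal_hessian_coord {v : ℝ → EuclideanSpace ℝ (Fin 3) → EuclideanSpace ℝ (Fin 3)} (hv : InDoorClass C v)
    (hsign : SignE3 v) (hpos : ∃ s < 0, ∃ y, 0 < ⟪curl (v s) y, e3⟫) :
    ∃ W : ℝ → EuclideanSpace ℝ (Fin 3) → EuclideanSpace ℝ (Fin 3), InDoorClass C W ∧ SignE3 W ∧
      0 < ∫ y, heatKernel 1 y * curl (W (-1)) y 2 ∧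
      (∀ i : Fin 3, ∫ y, (y i) ^ 2 * heatKernel 1 y * curl (W (-1)) y 2 ≤ 2 * ∫ y, heatKernel 1 y * curl (W (-1)) y 2) ∧
      ∫ y, ((y 0) ^ 2 + (y 1) ^ 2) * heatKernel 1 y * curl (W (-1)) y 2 ≤ 4 * ∫ y, heatKernel 1 y * curl (W (-1)) y 2 ∧
      2 * ∫ y, heatKernel 1 y * curl (W (-1)) y 2 ≤ ∫ y, ‖y‖ ^ 2 * heatKernel 1 y * curl (W (-1)) y 2 ∧
      gaussInflow 1 0 (W (-1)) = -2 * ((4 * Real.pi) ^ ((3 : ℝ) / 2) * 2 * ∫ y, heatKernel 1 y * curl (W (-1)) y 2) := by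
  obtain ⟨W, hW, hWs, h0, hdir, hlow, hI⟩ := gaussExtremal_hessian hv hsign hpos
  have hm1 : (-1 : ℝ) < 0 := by norm_num
  have hcomp : (fun y : EuclideanSpace ℝ (Fin 3) => heatKernel 1 y * ⟪curl (W (-1)) y, e3⟫) =
      fun y => heatKernel 1 y * curl (W (-1)) y 2 := by funext y; rw [inner_e3_apply]
  have hcomp2 : (fun y : EuclideanSpace ℝ (Fin 3) => ‖y‖ ^ 2 * heatKernel 1 y * ⟪curl (W (-1)) y, e3⟫) =
      fun y => ‖y‖ ^ 2 * heatKernel 1 y * curl (W (-1)) y 2 := by funext y; rw [inner_e3_apply]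
  have hcompd : ∀ e : EuclideanSpace ℝ (Fin 3), (fun y : EuclideanSpace ℝ (Fin 3) => ⟪y, e⟫ ^ 2 * heatKernel 1 y * ⟪curl (W (-1)) y, e3⟫) =
      fun y => ⟪y, e⟫ ^ 2 * heatKernel 1 y * curl (W (-1)) y 2 := fun e => by funext y; rw [inner_e3_apply]
  rw [hcomp] at h0 hlow hI hdir
  rw [hcomp2] at hlow
  simp_rw [hcompd] at hdir
  -- coordinate moments
  have hcoord : ∀ i : Fin 3, ∫ y, (y i) ^ 2 * heatKernel 1 y * curl (W (-1)) y 2 ≤ 2 * ∫ y, heatKernel 1 y * curl (W (-1)) y 2 := by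
    intro i
    have h := hdir (EuclideanSpace.single i (1 : ℝ))
    have hn : ‖EuclideanSpace.single i (1 : ℝ)‖ = 1 := by simp
    simp_rw [inner_single_one_eq, hn] at h
    simpa using h
  -- integrability of the coordinate moments (bounded continuous × Gaussian second moment)
  obtain ⟨-, -, hωc, K, hωK⟩ := slice_components hW hm1
  have hG1c : Continuous fun y : EuclideanSpace ℝ (Fin 3) => heatKernel 1 y := by unfold heatKernel; fun_prop
  have hcont_yi : ∀ i : Fin 3, Continuous fun y : EuclideanSpace ℝ (Fin 3) => y i := fun i =>
    (continuous_apply i).comp (PiLp.continuous_ofLp 2 _)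
  have hint2 : Integrable (fun y : EuclideanSpace ℝ (Fin 3) => ‖y‖ ^ 2 * heatKernel 1 y * curl (W (-1)) y 2) := by
    refine ((integrable_norm_sq_mul_heatKernel (E := EuclideanSpace ℝ (Fin 3)) one_pos).mul_const K).mono' ?_
      (ae_of_all _ fun y => ?_)
    · exact (((continuous_norm.pow 2).mul hG1c).mul (hωc 2)).aestronglyMeasurable
    · have hG : 0 ≤ ‖y‖ ^ 2 * heatKernel 1 y := mul_nonneg (sq_nonneg _) (heatKernel_pos one_pos _).le
      rw [Real.norm_eq_abs, abs_mul, abs_of_nonneg hG]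
      exact mul_le_mul_of_nonneg_left (hωK 2 y) hG
  have hinti : ∀ i : Fin 3, Integrable (fun y : EuclideanSpace ℝ (Fin 3) => (y i) ^ 2 * heatKernel 1 y * curl (W (-1)) y 2) := by
    intro i
    refine hint2.mono ((((hcont_yi i).pow 2).mul hG1c).mul (hωc 2)).aestronglyMeasurable (ae_of_all _ fun y => ?_)
    have hG : 0 ≤ heatKernel 1 y := (heatKernel_pos one_pos _).le
    have hyi : (y i) ^ 2 ≤ ‖y‖ ^ 2 := by
      have h : |y i| ≤ ‖y‖ := by rw [← Real.norm_eq_abs]; exact PiLp.norm_apply_le y i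
      have h' := pow_le_pow_left₀ (abs_nonneg _) h 2
      rwa [sq_abs] at h'
    rw [Real.norm_eq_abs, abs_mul, abs_mul, abs_of_nonneg (sq_nonneg (y i)), abs_of_nonneg hG, Real.norm_eq_abs, abs_mul, abs_mul,
      abs_of_nonneg (sq_nonneg ‖y‖), abs_of_nonneg hG]
    gcongr
  have hhor : ∫ y, ((y 0) ^ 2 + (y 1) ^ 2) * heatKernel 1 y * curl (W (-1)) y 2 =
      (∫ y, (y 0) ^ 2 * heatKernel 1 y * curl (W (-1)) y 2) + ∫ y, (y 1) ^ 2 * heatKernel 1 y * curl (W (-1)) y 2 := by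
    rw [← integral_add (hinti 0) (hinti 1)]
    congr 1; funext y; ring
  refine ⟨W, hW, hWs, h0, hcoord, ?_, hlow, hI⟩
  rw [hhor]
  have h0' := hcoord 0
  have h1' := hcoord 1
  linarith


/-! ### Reductions of W6 and of the crux -/

/-- **REDUCTION: W6 from the Hessian condition.**  If no closed-hemisphere door-class profile has, at `(t, τ, y₀) = (1, −1, 0)`, positive
Gaussian vertical vorticity whose directional Gaussian second moments are all `≤ 2‖e‖²·∫G₁ω₃`, with `2∫G₁ω₃ ≤ ∫‖y‖²G₁ω₃` and the
maximal-inflow identity, then `HemisphereLiouvilleE3` holds. -/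
theorem hemisphereLiouvilleE3_of_hessian
    (h : ∀ (C : ℝ) (W : ℝ → EuclideanSpace ℝ (Fin 3) → EuclideanSpace ℝ (Fin 3)), InDoorClass C W → SignE3 W →
      0 < ∫ y, heatKernel 1 y * ⟪curl (W (-1)) y, e3⟫ →
      (∀ e : EuclideanSpace ℝ (Fin 3),
        ∫ y, ⟪y, e⟫ ^ 2 * heatKernel 1 y * ⟪curl (W (-1)) y, e3⟫ ≤ 2 * ‖e‖ ^ 2 * ∫ y, heatKernel 1 y * ⟪curl (W (-1)) y, e3⟫) →
      2 * ∫ y, heatKernel 1 y * ⟪curl (W (-1)) y, e3⟫ ≤ ∫ y, ‖y‖ ^ 2 * heatKernel 1 y * ⟪curl (W (-1)) y, e3⟫ →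
      gaussInflow 1 0 (W (-1)) = -2 * ((4 * Real.pi) ^ ((3 : ℝ) / 2) * 2 * ∫ y, heatKernel 1 y * ⟪curl (W (-1)) y, e3⟫) → False) :
    HemisphereLiouvilleE3 := by
  intro C v hrate hcont hmild hdiv hsign s hs y
  by_contra hne
  have hpos : 0 < ⟪curl (v s) y, e3⟫ := lt_of_le_of_ne (hsign s hs y) (Ne.symm hne)
  obtain ⟨W, hW, hWs, h0, h1, h2, h3⟩ := gaussExtremal_hessian (C := C) ⟨hrate, hcont, hmild, hdiv⟩ hsign ⟨s, hs, y, hpos⟩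
  exact h C W hW hWs h0 h1 h2 h3

/-- **The crux from the Hessian condition** (composition with the landed plumbing `stub_rotate`). -/
theorem circulationCarryingRigidity_of_hessian
    (h : ∀ (C : ℝ) (W : ℝ → EuclideanSpace ℝ (Fin 3) → EuclideanSpace ℝ (Fin 3)), InDoorClass C W → SignE3 W →
      0 < ∫ y, heatKernel 1 y * ⟪curl (W (-1)) y, e3⟫ →
      (∀ e : EuclideanSpace ℝ (Fin 3),
        ∫ y, ⟪y, e⟫ ^ 2 * heatKernel 1 y * ⟪curl (W (-1)) y, e3⟫ ≤ 2 * ‖e‖ ^ 2 * ∫ y, heatKernel 1 y * ⟪curl (W (-1)) y, e3⟫) →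
      2 * ∫ y, heatKernel 1 y * ⟪curl (W (-1)) y, e3⟫ ≤ ∫ y, ‖y‖ ^ 2 * heatKernel 1 y * ⟪curl (W (-1)) y, e3⟫ →
      gaussInflow 1 0 (W (-1)) = -2 * ((4 * Real.pi) ^ ((3 : ℝ) / 2) * 2 * ∫ y, heatKernel 1 y * ⟪curl (W (-1)) y, e3⟫) → False) :
    CirculationCarryingRigidity :=
  circulationCarryingRigidity_of_hemisphereLiouvilleE3 (hemisphereLiouvilleE3_of_hessian h)

end Summit.NavierStokesRegularity.NavierStokesRegularity.Theorems.HalfSpaceWindowDoorCirculationCarryingRigidityGaussExtremalHessian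

end
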